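import Mathlib
import Summits.NavierStokesRegularity.NavierStokesRegularity.Theorems.EulerZoomLiouvillePowerGaugeEulerLiouvilleQVorticityWeight
import Summits.NavierStokesRegularity.NavierStokesRegularity.Theorems.EulerZoomLiouvillePowerGaugeEulerLiouvilleDSSVorticitySupport
import HarnessLib

/-!
# DSS members of the power-gauged Euler class with DECAYING vorticity — the two levers
# (helper of the DSS vorticity-decay stratum of the crux `EulerZoomLiouville.PowerGaugeEulerLiouville`,
# route №10, item stmt-NavierStokesRegularity-19832)

Helper file (theorems only; `--supports stmt-NavierStokesRegularity-19832`). Seat ns-typeII-p3 (cell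
ns-regularity-ideate §B, D-0081), rung C2 (discretely self-similar members, NO symmetry). For a classical
Euler flow `u` on `(−∞, 0)` and the moving exterior weight of `…QVorticityWeight.lean` at blow-up time
`c = 0`, `W(τ, y) = ϑ(|y|² R₀⁻² |τ|^{−2n} − 1)`, `n = 1/(2+ρ)`, put `J(τ) = ∫ W(τ)² |curl u(τ)|^q`.

* SCALING LEVER (`integral_weight_rpow_dss`): if `u` is discretely self-similar for the class scaling,
  `u(τ, y) = l^{1+ρ} u(l^{2+ρ}τ, l y)`, then `J(τ) = (l^{2+ρ})^q (l³)⁻¹ J(l^{2+ρ}τ)` — the weight is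
  scale invariant (`(2+ρ)·2n = 2`) and `curl` scales by `l^{2+ρ}`; so over one period BACKWARD in time
  `J` grows by the factor `l^{3 − q(2+ρ)} > 1` when `q < 3/(2+ρ)`.
* DYNAMICAL LEVER (`weight_rpow_interval_ge`): if on the far region `|y| ≥ R₀|τ|^n` the scale-invariant
  bounds `|τ| ‖∇u(τ, y)‖ ≤ δ` and `|τ| |u(τ, y)| ≤ n |y|` hold, then for `a < b < 0`
  `J(b) ≥ J(a) − q (δ/|b|) ∫₀^{b−a} J(σ + a) dσ` (the weighted `q`-enstrophy inequality of
  `…QVorticityInequality.lean` for the time-shifted flow, the weight being outgoing by `weight_outgoing`).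

WHAT THIS IS NOT: not NS, not the crux — the two a priori facts combined in the sequel
`…DSSVorticityDecay.lean` (Chae–Tsai, MRL 21 (2014) Thm 2.2 in physical variables). [folklore]
-/

noncomputable section

-- the summit and its single problem share the name `NavierStokesRegularity` (D-0017 nested layout)
set_option linter.dupNamespace false

open Set Function Filter Topology MeasureTheory Metric Module
open scoped NNReal ENNReal InnerProductSpace RealInnerProductSpace

namespace Summit.NavierStokesRegularity.NavierStokesRegularity.Theorems.PowerGaugeEulerLiouville.VorticityDecay

open Literature.Analysis Literature.Analysis.FluidPDE
open Summit.NavierStokesRegularity.NavierStokesRegularity.Theorems.PowerGaugeEulerLiouville.AxisymNoSwirl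

/-! ## The scaling lever -/

/-- **Scale invariance of the weight**: `W(τ, y) = W(l^{2+ρ}τ, l y)` for `n = 1/(2+ρ)`, `l > 0`, `τ < 0`.
[folklore] -/
theorem weight_dss_invariant {ρ l R₀ τ : ℝ} (hρ : 0 < 2 + ρ) (hl : 0 < l) (hτ : τ < 0)
    (y : EuclideanSpace ℝ (Fin 3)) :
    Real.smoothTransition (‖l • y‖ ^ 2 * ((R₀ ^ 2)⁻¹ * (-(l ^ (2 + ρ) * τ)) ^ (-(2 * (2 + ρ)⁻¹))) - 1) =
      Real.smoothTransition (‖y‖ ^ 2 * ((R₀ ^ 2)⁻¹ * (-τ) ^ (-(2 * (2 + ρ)⁻¹))) - 1) := by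
  congr 1
  have hL : 0 < l ^ (2 + ρ) := Real.rpow_pos_of_pos hl _
  have e1 : -(l ^ (2 + ρ) * τ) = l ^ (2 + ρ) * (-τ) := by ring
  have e2 : (l ^ (2 + ρ) * (-τ)) ^ (-(2 * (2 + ρ)⁻¹)) =
      (l ^ (2 + ρ)) ^ (-(2 * (2 + ρ)⁻¹)) * (-τ) ^ (-(2 * (2 + ρ)⁻¹)) :=
    Real.mul_rpow hL.le (by linarith)
  have e3 : (l ^ (2 + ρ)) ^ (-(2 * (2 + ρ)⁻¹)) = (l ^ 2)⁻¹ := by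
    rw [← Real.rpow_mul hl.le, show (2 + ρ) * -(2 * (2 + ρ)⁻¹) = -(2 : ℝ) by field_simp,
      Real.rpow_neg hl.le, Real.rpow_two]
  rw [e1, e2, e3, norm_smul, Real.norm_of_nonneg hl.le, mul_pow]
  field_simp

/-- **The scaling lever.** For a DSS flow `u(τ, y) = l^{1+ρ} u(l^{2+ρ}τ, l y)` (`l > 0`, `2 + ρ > 0`) with
`u(l^{2+ρ}τ)` differentiable, the weighted `q`-power of the vorticity satisfies
`J(τ) = (l^{2+ρ})^q (l³)⁻¹ J(l^{2+ρ} τ)`. [folklore] -/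
theorem integral_weight_rpow_dss {ρ l R₀ q τ : ℝ} (hρ : 0 < 2 + ρ) (hl : 0 < l) (hτ : τ < 0)
    {u : ℝ → EuclideanSpace ℝ (Fin 3) → EuclideanSpace ℝ (Fin 3)}
    (hd : Differentiable ℝ (u (l ^ (2 + ρ) * τ)))
    (hdss : ∀ y, u τ y = (l ^ (1 + ρ)) • u ((l ^ (2 + ρ)) * τ) (l • y)) :
    ∫ y, Real.smoothTransition (‖y‖ ^ 2 * ((R₀ ^ 2)⁻¹ * (-τ) ^ (-(2 * (2 + ρ)⁻¹))) - 1) ^ 2 *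
        ‖curl (u τ) y‖ ^ q =
      (l ^ (2 + ρ)) ^ q * (l ^ 3)⁻¹ *
        ∫ y, Real.smoothTransition (‖y‖ ^ 2 * ((R₀ ^ 2)⁻¹ * (-(l ^ (2 + ρ) * τ)) ^ (-(2 * (2 + ρ)⁻¹))) - 1) ^ 2 *
          ‖curl (u (l ^ (2 + ρ) * τ)) y‖ ^ q := by
  have hfun : u τ = fun z => (l ^ (1 + ρ)) • u ((l ^ (2 + ρ)) * τ) (l • z) := funext hdss
  have hL : 0 < l ^ (2 + ρ) := Real.rpow_pos_of_pos hl _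
  have hcl : l ^ (1 + ρ) * l = l ^ (2 + ρ) := by
    rw [← Real.rpow_add_one hl.ne']; ring_nf
  -- pointwise form of the integrand
  have hpt : ∀ y, Real.smoothTransition (‖y‖ ^ 2 * ((R₀ ^ 2)⁻¹ * (-τ) ^ (-(2 * (2 + ρ)⁻¹))) - 1) ^ 2 *
      ‖curl (u τ) y‖ ^ q = (l ^ (2 + ρ)) ^ q *
      (fun z => Real.smoothTransition (‖z‖ ^ 2 * ((R₀ ^ 2)⁻¹ * (-(l ^ (2 + ρ) * τ)) ^ (-(2 * (2 + ρ)⁻¹))) - 1) ^ 2 *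
        ‖curl (u (l ^ (2 + ρ) * τ)) z‖ ^ q) (l • y) := by
    intro y
    rw [hfun, curl_smul_comp_smul hd, hcl, norm_smul, Real.norm_of_nonneg hL.le,
      Real.mul_rpow hL.le (norm_nonneg _), ← weight_dss_invariant (R₀ := R₀) hρ hl hτ y]
    ring
  rw [integral_congr_ae (Eventually.of_forall hpt), integral_const_mul,
    Measure.integral_comp_smul volume (fun z : EuclideanSpace ℝ (Fin 3) =>
      Real.smoothTransition (‖z‖ ^ 2 * ((R₀ ^ 2)⁻¹ * (-(l ^ (2 + ρ) * τ)) ^ (-(2 * (2 + ρ)⁻¹))) - 1) ^ 2 *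
        ‖curl (u (l ^ (2 + ρ) * τ)) z‖ ^ q) l,
    finrank_euclideanSpace_fin, abs_of_pos (inv_pos.2 (pow_pos hl 3)), smul_eq_mul]
  ring

/-- **The scaling factor**: `(l^{2+ρ})^q (l³)⁻¹ · l^{3 − q(2+ρ)} = 1` (`l > 0`). [folklore] -/
theorem dss_scaling_factor_mul {ρ l q : ℝ} (hl : 0 < l) :
    (l ^ (2 + ρ)) ^ q * (l ^ 3)⁻¹ * l ^ (3 - q * (2 + ρ)) = 1 := by
  rw [← Real.rpow_mul hl.le, Real.rpow_sub hl, ← Real.rpow_natCast l 3]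
  push_cast
  rw [show (2 + ρ) * q = q * (2 + ρ) by ring]
  have h3 : 0 < l ^ (3 : ℝ) := Real.rpow_pos_of_pos hl _
  have hq : 0 < l ^ (q * (2 + ρ)) := Real.rpow_pos_of_pos hl _
  field_simp

/-! ## The dynamical lever on a time interval `[a, b] ⊂ (−∞, 0)` -/

/-- **The weighted `q`-enstrophy inequality on `[a, b]`, `a < b < 0`**, for a classical Euler flow on
`(−∞, 0)` with bounded `u, ∇u` on `[a, b]`, `∫|curl u(τ)|^q ≤ N` on `[a, b]`, and the scale-invariant
far-field bounds `|τ| ‖∇u(τ,y)‖ ≤ δ`, `|τ| |u(τ,y)| ≤ n |y|` for `|y| ≥ R₀ |τ|^n` (`n = 1/(2+ρ) > 0`):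
`J(b) ≥ J(a) − q (δ/|b|) ∫₀^{b−a} J(σ + a) dσ`. [folklore] -/
theorem weight_rpow_interval_ge {ρ R₀ δ q a b : ℝ} (hρ : 0 < 2 + ρ) (hR : 0 < R₀) (hδ : 0 ≤ δ) (hq : 0 < q)
    (hab : a < b) (hb : b < 0)
    {u : ℝ → EuclideanSpace ℝ (Fin 3) → EuclideanSpace ℝ (Fin 3)} {p : ℝ → EuclideanSpace ℝ (Fin 3) → ℝ}
    (hns : IsClassicalNSSolutionOn (Iio 0) 0 0 u p)
    {B : ℝ} (hB : ∀ τ ∈ Icc a b, ∀ y, ‖u τ y‖ ≤ B ∧ ‖fderiv ℝ (u τ) y‖ ≤ B)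
    {N : ℝ} (hN : ∀ τ ∈ Icc a b, Integrable (fun y => ‖curl (u τ) y‖ ^ q) ∧ ∫ y, ‖curl (u τ) y‖ ^ q ≤ N)
    (hfar : ∀ τ : ℝ, τ < 0 → ∀ y : EuclideanSpace ℝ (Fin 3), R₀ * (-τ) ^ (2 + ρ)⁻¹ ≤ ‖y‖ →
      (-τ) * ‖fderiv ℝ (u τ) y‖ ≤ δ ∧ (-τ) * ‖u τ y‖ ≤ (2 + ρ)⁻¹ * ‖y‖) :
    (∫ y, Real.smoothTransition (‖y‖ ^ 2 * ((R₀ ^ 2)⁻¹ * (-a) ^ (-(2 * (2 + ρ)⁻¹))) - 1) ^ 2 *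
        ‖curl (u a) y‖ ^ q) -
      q * (δ / (-b)) * (∫ σ in Ioo 0 (b - a), ∫ y,
        Real.smoothTransition (‖y‖ ^ 2 * ((R₀ ^ 2)⁻¹ * (-(σ + a)) ^ (-(2 * (2 + ρ)⁻¹))) - 1) ^ 2 *
          ‖curl (u (σ + a)) y‖ ^ q) ≤
      ∫ y, Real.smoothTransition (‖y‖ ^ 2 * ((R₀ ^ 2)⁻¹ * (-b) ^ (-(2 * (2 + ρ)⁻¹))) - 1) ^ 2 *
        ‖curl (u b) y‖ ^ q := by
  -- the time-shifted flow on `[0, T]`, `T = b - a`, blow-up time `c = -a`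
  set T : ℝ := b - a with hT'
  have hT : 0 < T := sub_pos.2 hab
  have hTc : T < -a := by rw [hT']; linarith
  have hn : 0 ≤ (2 + ρ)⁻¹ := inv_nonneg.2 hρ.le
  have hsub : Icc 0 T ⊆ (fun σ : ℝ => σ + a) ⁻¹' Iio (0 : ℝ) := by
    intro σ hσ; show σ + a < 0; have := hσ.2; rw [hT'] at this; linarith
  have hmem : ∀ σ ∈ Icc 0 T, σ + a ∈ Icc a b := fun σ hσ =>
    ⟨by linarith [hσ.1], by have := hσ.2; rw [hT'] at this; linarith⟩
  have hv : IsClassicalNSSolutionOn (Icc 0 T) 0 0 (fun σ => u (σ + a)) (fun σ => p (σ + a)) :=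
    (hns.comp_add_right a).mono hsub (uniqueDiffOn_Icc hT)
  -- the weight with `c = -a`; note `-a - σ = -(σ + a)`
  have hΘ := isSmoothSpaceTimeOn_weight (T := T) (c := -a) R₀ hTc (2 + ρ)⁻¹
  obtain ⟨M, hM⟩ := exists_bound_deriv_weight (T := T) (c := -a) hR hT hTc hn
  have hΘM : ∀ σ ∈ Icc 0 T, ∀ y : EuclideanSpace ℝ (Fin 3),
      |Real.smoothTransition (‖y‖ ^ 2 * ((R₀ ^ 2)⁻¹ * (-a - σ) ^ (-(2 * (2 + ρ)⁻¹))) - 1)| ≤ 1 ∧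
      |FluidPDE.timeDerivWithin (Icc 0 T) (fun s (y : EuclideanSpace ℝ (Fin 3)) =>
          Real.smoothTransition (‖y‖ ^ 2 * ((R₀ ^ 2)⁻¹ * (-a - s) ^ (-(2 * (2 + ρ)⁻¹))) - 1)) σ y| ≤ M ∧
        ‖fderiv ℝ (fun y : EuclideanSpace ℝ (Fin 3) =>
          Real.smoothTransition (‖y‖ ^ 2 * ((R₀ ^ 2)⁻¹ * (-a - σ) ^ (-(2 * (2 + ρ)⁻¹))) - 1)) y‖ ≤ M := by
    intro σ hσ y
    have hv01 := (weight_values (c := -a) (R₀ := R₀) hR (hσ.2.trans_lt hTc) (2 + ρ)⁻¹ y).1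
    exact ⟨abs_le.2 ⟨by linarith [hv01.1], hv01.2⟩, hM σ hσ y⟩
  -- far-field hypotheses in shifted time
  have hvel : ∀ σ ∈ Icc 0 T, ∀ y : EuclideanSpace ℝ (Fin 3), R₀ * (-a - σ) ^ (2 + ρ)⁻¹ ≤ ‖y‖ →
      (-a - σ) * ‖u (σ + a) y‖ ≤ (2 + ρ)⁻¹ * ‖y‖ := by
    intro σ hσ y hy
    have e : -a - σ = -(σ + a) := by ring
    rw [e] at hy ⊢
    exact (hfar (σ + a) (hsub hσ) y hy).2
  have hgrad : ∀ σ ∈ Icc 0 T, ∀ y : EuclideanSpace ℝ (Fin 3), R₀ * (-a - σ) ^ (2 + ρ)⁻¹ ≤ ‖y‖ →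
      (-a - σ) * ‖fderiv ℝ (u (σ + a)) y‖ ≤ δ := by
    intro σ hσ y hy
    have e : -a - σ = -(σ + a) := by ring
    rw [e] at hy ⊢
    exact (hfar (σ + a) (hsub hσ) y hy).1
  have hout := fun σ (hσ : σ ∈ Icc 0 T) y =>
    weight_outgoing (v := fun σ => u (σ + a)) hR hT hTc hvel hσ y
  have hκ := fun σ (hσ : σ ∈ Icc 0 T) y =>
    norm_fderiv_le_of_weight_ne_zero (v := fun σ => u (σ + a)) (n := (2 + ρ)⁻¹) hR hTc hδ hgrad hσ y
  have hκ0 : 0 ≤ δ / (-a - T) := div_nonneg hδ (by linarith)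
  have hineq := integral_weight_rpow_ge hT hv (fun σ hσ => hB (σ + a) (hmem σ hσ)) hΘ hΘM
    (fun σ hσ y => (weight_values (c := -a) (R₀ := R₀) hR (hσ.2.trans_lt hTc) (2 + ρ)⁻¹ y).1.1)
    hout hκ0 hκ hq (fun σ hσ => hN (σ + a) (hmem σ hσ))
  -- translate back to absolute times
  have eT : T + a = b := by rw [hT']; ring
  have eb : -a - T = -b := by rw [hT']; ring
  have e0 : -a - (0 : ℝ) = -a := by ring
  simp only [zero_add, eT, eb, e0] at hineq
  have eσ : ∀ σ : ℝ, -a - σ = -(σ + a) := fun σ => by ring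
  simp only [eσ] at hineq
  exact hineq

end Summit.NavierStokesRegularity.NavierStokesRegularity.Theorems.PowerGaugeEulerLiouville.VorticityDecay

end
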